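import Mathlib
import Summits.Ventures.HodgeRepro2.T5LocalNormIndex
import Summits.Ventures.HodgeRepro2.T5AdicCompletionSelfDuality
import Summits.Ventures.HodgeRepro2.T5AdicCompletionRamified
import Summits.Ventures.HodgeRepro2.T6N5TateTwist
import Summits.Ventures.HodgeRepro2.T6N5Hyp
import Summits.Ventures.HodgeRepro2.T6N5LocalDatum
import Summits.Ventures.HodgeRepro2.T6N5LocalCharDatum
import Summits.Ventures.HodgeRepro2.T6N5LocalInertHyp
import Summits.Ventures.HodgeRepro2.T6N5LocalInert
import Summits.Ventures.HodgeRepro2.T6N5LocalInertCompletion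
import Summits.Ventures.HodgeRepro2.T6N5LocalInertOnCompletion
import Summits.Ventures.HodgeRepro2.T6N5LocalTateChars
import Summits.Ventures.HodgeRepro2.T6N5LocalInertTateSide
import Summits.Ventures.HodgeRepro2.T6N5LocalInertToyEps

/-!
# T6N5LocalInertToyEpsDisplays — Tier 6, M2 sub-step N5 (t6-p8's half): the toy ε-factor at an inert place and the
two printed displays it satisfies (Tate (3.2.2)–(3.2.3), Gan–Gross–Prasad Prop. 3.1), with conjugate-symplectic
characters of both signs

Over `Q : InertPlace v w` with the self-duality shift `s_ψ` of `T6N5LocalInertToyEps`: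
* `epsToy χ ψ dx := dx · χ(s_ψ) · ‖s_ψ‖⁻¹ · (−1)^{a(χ)+1} · dx_{ψ₁}⁻¹`, `toyP` (with `χ_W := μ`, the unramified
  conjugate-symplectic character, `ϵ_δ(W) = 1`), `Dt` the toy inert datum over `ψ_δ := ψ₁`;
* `hT_toy`: (3.2.2) scaling and (3.2.3) twisting hold for EVERY `χ`, `ψ`, `dx`, `a`;
* `hG_toy`: for a normalised `ψ` and a conjugate-symplectic smooth `ξ`, `ε(½, ξ, ψ) = (−1)^{a(ξ)+1}`;
* `hμ_toy`, `hβ_toy` (the datum conditions), `exists_isCS_eps_eq_toy` (both signs: conductors `1` and `2`),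
  `exists_isCO_eps_inv_χW_mul_eq` (the non-vacuity input of the quotient Weil toy).
README §8(d): uses an L-value-free non-vanishing device: NO.
-/

namespace Summit.Ventures.HodgeRepro2.T6.N5LocalInertToyEps

open Summit.Ventures.HodgeRepro2 IsDedekindDomain HeightOneSpectrum
  Summit.Ventures.HodgeRepro2.T6.N5LocalDatum Summit.Ventures.HodgeRepro2.T6.N5LocalCharDatum
  Summit.Ventures.HodgeRepro2.T6.N5LocalInertDatum Summit.Ventures.HodgeRepro2.T6.N5Local
  Summit.Ventures.HodgeRepro2.T6.N5LocalInert Summit.Ventures.HodgeRepro2.T6.Hyp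
  Summit.Ventures.HodgeRepro2.T6.N5LocalInertCompletion Summit.Ventures.HodgeRepro2.T6.N5LocalInertOnCompletion
  Summit.Ventures.HodgeRepro2.T6.N5LocalTateChars Summit.Ventures.HodgeRepro2.T6.N5LocalInertTateSide
  Summit.Ventures.HodgeRepro2.T5ConductorArithmetic

-- `K`, `L` in `Type` (universe `0`).
variable {K : Type} [Field K] [NumberField K] {v : HeightOneSpectrum (NumberField.RingOfIntegers K)}
  {L : Type} [Field L] [NumberField L] [Algebra K L] {w : HeightOneSpectrum (NumberField.RingOfIntegers L)}
  [w.asIdeal.LiesOver v.asIdeal]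
  [ContinuousSMul (v.adicCompletion K) (w.adicCompletion L)]
  [IsScalarTower K (v.adicCompletion K) (w.adicCompletion L)]

noncomputable section

namespace InertPlace

variable (Q : InertPlace v w)

/-! ### The toy ε-factor -/

omit [IsScalarTower K (v.adicCompletion K) (w.adicCompletion L)] in
/-- The toy ε-factor at an inert place: `ε(χ, ψ, dx) := dx · χ(s_ψ) · ‖s_ψ‖⁻¹ · (−1)^{a(χ)+1} · dx_{ψ₁}⁻¹`. -/
def epsToy (χ : (w.adicCompletion L)ˣ →* ℂˣ) (ψ : PsiC w) (dx : ℝ) : ℂ :=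
  (dx : ℂ) * ((χ (Q.shiftU ψ) : ℂˣ) : ℂ) * ((nrm w (Q.shiftU ψ) : ℝ) : ℂ)⁻¹ *
    (-1 : ℂ) ^ (conductor (U v w Q.ϖ) χ + 1) * ((sd w Q.ψ₁ : ℝ) : ℂ)⁻¹

omit [IsScalarTower K (v.adicCompletion K) (w.adicCompletion L)] in
/-- The toy parameters: the toy ε-factor, `χ_W := μ`, `ϵ_δ(W) = 1`, the theta predicate (replaced by the carried Weil
representation downstream), the line signs. -/
def toyP : TateParams (w.adicCompletion L)ˣ (PsiC w) ℝ where
  epsT := Q.epsToy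
  χW := μ w
  epsdW := 1
  Theta := fun _ _ => True
  ηLine := fun _ => 1
  ηu := 1

/-- The toy inert datum, over the datum's `ψ_δ := ψ₁` (normalised, trivial on `K_v`). -/
abbrev Dt : InertSignDatum :=
  mkInert v w Q.ϖ Q.σ Q.hind (mkTateSide v w Q.h2 Q.hϖ Q.hϖS Q.σ Q.hσ Q.toyP Q.ψ₁ Q.ψ₁_algebraMap)

/-! ### Tate's (3.2.2)–(3.2.3) -/

omit [IsScalarTower K (v.adicCompletion K) (w.adicCompletion L)] in
/-- TATE'S (3.2.2)–(3.2.3) HOLD FOR THE TOY ε-FACTOR: scaling in `dx`, and the twist `ψ_a` multiplies by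
`χ(a)·‖a‖⁻¹` (`s_{ψ_a} = s_ψ·a`). -/
theorem hT_toy : Tate1979_3_2_2_3 Q.epsToy (fun ξ a => ((ξ a : ℂˣ) : ℂ)) (twist w) (fun r m => r * m) (nrm w)
    (fun _ => True) := by
  refine ⟨fun χ ψ dx r _ => ?_, fun χ ψ dx a _ => ?_⟩
  · unfold epsToy
    push_cast
    ring
  · unfold epsToy
    rw [Q.shiftU_twist, map_mul, Units.val_mul, nrm_mul, Complex.ofReal_mul, mul_inv]
    ring

/-! ### Gan–Gross–Prasad's Proposition 3.1 -/

omit [IsScalarTower K (v.adicCompletion K) (w.adicCompletion L)] in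
/-- `ω_{1/2}` is unramified: trivial on `U 0 = O_{L_w}^×`. -/
theorem omega_half_unramified_U : U v w Q.ϖ 0 ≤ (omega w (1 / 2)).ker := by
  rintro x ⟨u, -, rfl⟩
  rw [MonoidHom.mem_ker]
  apply Units.ext
  rw [omega_apply, Units.val_one]
  have h1 : nrm w (intUnits w u) = 1 := by
    rw [nrm_eq]
    show (qE w : ℝ) ^ (Valued.v ((u : w.adicCompletionIntegers L) : w.adicCompletion L)).log = 1
    rw [T5AdicCompletionNormSurjective.val_coe_units_eq_one w u, WithZero.log_one, zpow_zero]
  rw [h1, Complex.ofReal_one, Complex.one_cpow]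

omit [ContinuousSMul (v.adicCompletion K) (w.adicCompletion L)]
  [IsScalarTower K (v.adicCompletion K) (w.adicCompletion L)] in
/-- `‖x‖ = 1` for `v(x) = 1`. -/
theorem nrm_eq_one_of_val (x : (w.adicCompletion L)ˣ) (hx : Valued.v (x : w.adicCompletion L) = 1) :
    nrm w x = 1 := by
  rw [nrm_eq, hx, WithZero.log_one, zpow_zero]

omit [IsScalarTower K (v.adicCompletion K) (w.adicCompletion L)] in
/-- `dx_ψ = dx_{ψ₁}` for a normalised `ψ` (both of conductor `−1`). -/
theorem sd_eq_of_normalised (ψ : PsiC w) (hψ : IsNormalisedC v w ψ) : sd w ψ = sd w Q.ψ₁ := by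
  unfold sd
  rw [cond_eq_neg_one_of_normalised ψ hψ, cond_eq_neg_one_of_normalised Q.ψ₁ Q.ψ₁_normalised]

omit [IsScalarTower K (v.adicCompletion K) (w.adicCompletion L)] in
/-- `dx_{ψ₁} ≠ 0`. -/
theorem sd_ψ₁_ne_zero : sd w Q.ψ₁ ≠ 0 :=
  (Real.sqrt_pos.mpr (zpow_pos (by exact_mod_cast qE_pos w) _)).ne'

omit [IsScalarTower K (v.adicCompletion K) (w.adicCompletion L)] in
/-- PROPOSITION 3.1 HOLDS FOR THE TOY ε-FACTOR: for a normalised `ψ` and a conjugate-symplectic smooth `ξ`,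
`ε(½, ξ, ψ) = (−1)^{a(ξ)+1}`. -/
theorem hG_toy : GGP2012ex_Prop3_1 Q.Dt := by
  intro _ ψ hψ ξ hCS hs
  change (w.adicCompletion L)ˣ →* ℂˣ at ξ
  have hψ' : IsNormalisedC v w ψ := hψ
  have hs' : ∃ n, U v w Q.ϖ n ≤ ξ.ker := hs
  obtain ⟨hval, hmem⟩ := Q.shiftU_normalised ψ hψ'
  have hU0 : Q.shiftU ψ ∈ U v w Q.ϖ 0 := mem_U_zero_of_val_eq_one v w Q.ϖ _ hval
  -- `ξ(s_ψ) = η_v(s_ψ) = μ(s_ψ) = 1`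
  have hξs : ξ (Q.shiftU ψ) = 1 := by
    have hCS' : ∀ x : Fsub v w, ξ x = ηF v w Q.σ Q.hind x :=
      fun x => (CharDatum.isCS_iff Q.Dt.toCharDatum ξ).mp hCS ⟨x.1, x.2⟩
    rw [hCS' ⟨_, hmem⟩, ← μ_eq_ηF v w Q.σ Q.hσ Q.h2 Q.hϖ Q.hϖS Q.hind ⟨_, hmem⟩]
    exact MonoidHom.mem_ker.mp (μ_mem_U_zero v w Q.ϖ hU0)
  have hnrm : nrm w (Q.shiftU ψ) = 1 := nrm_eq_one_of_val _ hval
  have hω : omega w (1 / 2) (Q.shiftU ψ) = 1 := MonoidHom.mem_ker.mp (Q.omega_half_unramified_U hU0)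
  have hcond : conductor (U v w Q.ϖ) (ξ * omega w (1 / 2)) = conductor (U v w Q.ϖ) ξ :=
    CharDatum.cond_mul_of_isUnramified Q.Dt.toCharDatum (U_antitone v w Q.ϖ) hs' Q.omega_half_unramified_U
  show Q.epsToy (ξ * omega w (1 / 2)) ψ (sd w ψ) = (-1 : ℂ) ^ (conductor (U v w Q.ϖ) ξ + 1)
  unfold epsToy
  rw [hcond, MonoidHom.mul_apply, hξs, hω, mul_one, Units.val_one, hnrm, Q.sd_eq_of_normalised ψ hψ',
    Complex.ofReal_one, inv_one, mul_one, mul_one]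
  have h0 : ((sd w Q.ψ₁ : ℝ) : ℂ) ≠ 0 := by exact_mod_cast Q.sd_ψ₁_ne_zero
  field_simp

/-! ### The datum conditions and both signs -/

omit [IsScalarTower K (v.adicCompletion K) (w.adicCompletion L)] in
/-- `hμ` of the toy datum: `μ` is conjugate-symplectic and unramified. -/
theorem hμ_toy : ∃ μ' : (w.adicCompletion L)ˣ →* ℂˣ, Q.Dt.toLocalSignDatum.IsCS μ' ∧ Q.Dt.IsUnramified μ' := by
  refine ⟨μ w, ?_, μ_mem_U_zero v w Q.ϖ⟩
  refine (CharDatum.isCS_iff Q.Dt.toCharDatum _).mpr fun x => ?_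
  exact μ_eq_ηF v w Q.σ Q.hσ Q.h2 Q.hϖ Q.hϖS Q.hind ⟨x.1, x.2⟩

omit [IsScalarTower K (v.adicCompletion K) (w.adicCompletion L)] in
/-- `hβ` of the toy datum: conjugate-orthogonal smooth characters of every exact level `n ≥ 1`. -/
theorem hβ_toy (n : ℕ) (hn : 1 ≤ n) :
    ∃ β : (w.adicCompletion L)ˣ →* ℂˣ, Q.Dt.toLocalSignDatum.IsCO β ∧ Q.Dt.IsSmooth β ∧ Q.Dt.cond β = n := by
  obtain ⟨β, hβF, hβs, hβc⟩ := exists_CO_exact_level v w Q.hϖ Q.hϖS Q.hf n hn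
  refine ⟨β, (CharDatum.isCO_iff Q.Dt.toCharDatum _).mpr fun x => hβF x.1 x.2, hβs, hβc⟩

omit [IsScalarTower K (v.adicCompletion K) (w.adicCompletion L)] in
/-- `ε_v(ξ) = (−1)^{a(ξ)+1}` on the toy datum for conjugate-symplectic smooth `ξ` (the datum's `ψ_δ = ψ₁` is
normalised). -/
theorem eps_toy (ξ : (w.adicCompletion L)ˣ →* ℂˣ) (hCS : Q.Dt.toLocalSignDatum.IsCS ξ) (hs : Q.Dt.IsSmooth ξ) :
    Q.Dt.eps ξ = Int.negOnePow ((conductor (U v w Q.ϖ) ξ : ℤ) + 1) := by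
  have h := Q.hG_toy ⟨Q.h2, Q.hϖS⟩ Q.ψ₁ Q.ψ₁_normalised ξ hCS hs
  show CharDatum.toSign (Q.Dt.tate.epsS (1 / 2) ξ Q.ψ₁) = _
  rw [h]
  have hc : Q.Dt.cond ξ = conductor (U v w Q.ϖ) ξ := rfl
  rw [hc, ← zpow_natCast]
  push_cast
  exact CharDatum.toSign_neg_one_zpow _

omit [IsScalarTower K (v.adicCompletion K) (w.adicCompletion L)] in
/-- BOTH SIGNS OCCUR on the toy datum: for each `s = ±1` a conjugate-symplectic smooth `χ` with `ε_v(χ) = s`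
(conductor `1` for `+1`, conductor `2` for `−1`). -/
theorem exists_isCS_eps_eq_toy (s : ℤˣ) :
    ∃ χ : (w.adicCompletion L)ˣ →* ℂˣ, Q.Dt.toLocalSignDatum.IsCS χ ∧ Q.Dt.IsSmooth χ ∧ Q.Dt.eps χ = s := by
  rcases Int.units_eq_one_or s with hs | hs
  · obtain ⟨χ, hCS, hsm, hc⟩ :=
      CharDatum.exists_isCS_cond Q.Dt.toCharDatum (U_antitone v w Q.ϖ) Q.hμ_toy Q.hβ_toy 1 le_rfl
    refine ⟨χ, hCS, hsm, ?_⟩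
    rw [Q.eps_toy χ hCS hsm, hs]
    have hc' : conductor (U v w Q.ϖ) χ = 1 := hc
    rw [hc']
    decide
  · obtain ⟨χ, hCS, hsm, hc⟩ :=
      CharDatum.exists_isCS_cond Q.Dt.toCharDatum (U_antitone v w Q.ϖ) Q.hμ_toy Q.hβ_toy 2 (by norm_num)
    refine ⟨χ, hCS, hsm, ?_⟩
    rw [Q.eps_toy χ hCS hsm, hs]
    have hc' : conductor (U v w Q.ϖ) χ = 2 := hc
    rw [hc']
    decide

omit [IsScalarTower K (v.adicCompletion K) (w.adicCompletion L)] in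
/-- BOTH SIGNS on conjugate-orthogonal smooth `α` through `χ_W⁻¹·α = μ⁻¹·α`: for each `s` a conjugate-orthogonal
smooth `α` with `ε_v(χ_W⁻¹ α) = s` (the non-vacuity input of the quotient Weil toy). -/
theorem exists_isCO_eps_inv_χW_mul_eq (s : ℤˣ) :
    ∃ α : Q.Dt.E →* ℂˣ, Q.Dt.toLocalSignDatum.IsCO α ∧ Q.Dt.IsSmooth α ∧ Q.Dt.eps (Q.Dt.χW⁻¹ * α) = s := by
  obtain ⟨χ, hCS, hs, heps⟩ := Q.exists_isCS_eps_eq_toy s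
  change (w.adicCompletion L)ˣ →* ℂˣ at χ
  have hCS' : ∀ x : Fsub v w, χ x = ηF v w Q.σ Q.hind x :=
    fun x => (CharDatum.isCS_iff Q.Dt.toCharDatum χ).mp hCS ⟨x.1, x.2⟩
  let α : (w.adicCompletion L)ˣ →* ℂˣ := MonoidHom.mk' (fun x => μ w x * χ x)
    (fun x y => by rw [map_mul, map_mul]; exact mul_mul_mul_comm _ _ _ _)
  have hα' : ∀ x, α x = μ w x * χ x := fun x => rfl
  have hCO : ∀ x : Fsub v w, α x = 1 := by
    intro x
    rw [hα', μ_eq_ηF v w Q.σ Q.hσ Q.h2 Q.hϖ Q.hϖS Q.hind x, hCS' x]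
    have h := congrArg (fun φ : Fsub v w →* ℂˣ => φ x) (N5LocalInertOnCompletion.ηF_mul_self v w Q.σ Q.hind)
    simpa using h
  have hsm : ∃ n, U v w Q.ϖ n ≤ α.ker := by
    obtain ⟨n₂, hn₂⟩ := hs
    have hn₂' : U v w Q.ϖ n₂ ≤ χ.ker := hn₂
    refine ⟨n₂, fun x hx => ?_⟩
    rw [MonoidHom.mem_ker, hα', MonoidHom.mem_ker.mp (μ_mem_U_zero v w Q.ϖ (U_antitone v w Q.ϖ (Nat.zero_le n₂) hx)),
      MonoidHom.mem_ker.mp (hn₂' hx), mul_one]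
  have hmul : (μ w)⁻¹ * α = χ := by
    refine MonoidHom.ext fun x => ?_
    rw [MonoidHom.mul_apply, MonoidHom.inv_apply, hα', inv_mul_cancel_left]
  refine ⟨α, (CharDatum.isCO_iff Q.Dt.toCharDatum _).mpr fun x => hCO ⟨x.1, x.2⟩, hsm, ?_⟩
  show Q.Dt.eps ((μ w)⁻¹ * α) = s
  rw [hmul]
  exact heps

end InertPlace

end

end Summit.Ventures.HodgeRepro2.T6.N5LocalInertToyEps
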